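import Literature.NumberTheory.Automorphic.UnitaryRankThreeIsotropicCharacters
import HarnessLib

/-!
# Rank-3 isotropic unitary groups, IV: diagonal isotropic forms (Witt frame and transport)

Topic `NumberTheory/Automorphic`; namespace `Literature.NumberTheory.Automorphic.UnitaryRankThree`.  KERNEL only
(theorems, no definition, no notation, no named fact, no `sorry`).

For a field `K` with `2 ≠ 0`, an involution `σ` with `σ θ₀ = −θ₀ ≠ 0`, and a DIAGONAL `σ`-hermitian form
`diag(d₀, d₁, d₂)` (`σ dᵢ = dᵢ ≠ 0`) admitting an ISOTROPIC vector (`∑ σ(xᵢ) dᵢ xᵢ = 0`, `x ≠ 0`), every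
homomorphism `χ : unitaryGroupOfForm σ (diagonal d) →* A` to a commutative group kills the elements of determinant
one: **`apply_eq_one_of_det_eq_one_diagonal`** — `SU ≤ ker χ` [Dieudonne1971GroupesClassiques, Chap. II §5].

Route: an explicit Witt frame `T = (e ∣ v ∣ f)` with `e = (1, x₁, x₂)` the normalised isotropic vector,
`v = (0, d₂ σx₂, −d₁ σx₁)`, `f = (θ₀ / 2d₀) (1, −x₁, −x₂)` has `σ(T)ᵀ diag(d) T = !![0,0,θ₀; 0,c,0; −θ₀,0,0]` with
`c = −d₀d₁d₂` (`formCongr_frame`), so conjugation by `T` (`conj_mem_unitaryGroupOfForm_iff`,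
`UnitaryGroupFormTransport`) carries Part III's `apply_eq_one_of_det_eq_one'` over; an isotropic vector with
`x₀ = 0` is first moved by a coordinate permutation (`reindex_mem_unitaryGroupOfForm_iff`).

This is the field engine consumed at the NON-SPLIT finite places (with [Jacobowitz1962]-class local isotropy,
tree `QuadraticForms/HermitianLocalIsotropy`) and at the INDEFINITE complex places of the adelic factorisation
of characters of `U(J)(𝔸)` through `det` (`UnitaryGroupAdelicCharactersDet`).

## References

* J. Dieudonné, *La géométrie des groupes classiques*, 3e éd., Springer (1971), Chap. II §§4–5
  [Dieudonne1971GroupesClassiques].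
-/

set_option autoImplicit false

open Matrix

namespace Literature.NumberTheory.Automorphic

namespace UnitaryRankThree

variable {K : Type*} [Field K] {σ : K →+* K} {θ₀ : K} {A : Type*} [CommGroup A]

/-! ## §1 Transport of `SU ≤ ker χ` along a change of basis and along a reindexing -/

/-- If `σ(T)ᵀ H T = H'` and `SU(H') ≤ ker χ'` for every `χ'`, then `SU(H) ≤ ker χ` for every `χ`
(conjugation by `T`, determinant preserved). [cite: PlatonovRapinchuk1994, §2.3] -/
theorem apply_eq_one_of_det_eq_one_of_formCongr {n : Type*} [Fintype n] [DecidableEq n] (T : GL n K)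
    (H H' : Matrix n n K) (hT : formCongr σ T H = H')
    (hH' : ∀ (χ' : ↥(unitaryGroupOfForm σ H') →* A) (g' : ↥(unitaryGroupOfForm σ H')), g'.1.1.det = 1 → χ' g' = 1)
    (χ : ↥(unitaryGroupOfForm σ H) →* A) (g : ↥(unitaryGroupOfForm σ H)) (hdet : g.1.1.det = 1) : χ g = 1 := by
  subst hT
  -- conjugation by `T` as a homomorphism `U(σ, σ(T)ᵀ H T) →* U(σ, H)`
  let ψ : ↥(unitaryGroupOfForm σ (formCongr σ T H)) →* ↥(unitaryGroupOfForm σ H) :=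
    (((MulAut.conj T).toMonoidHom.restrict (unitaryGroupOfForm σ (formCongr σ T H))).codRestrict
      (unitaryGroupOfForm σ H) (fun g' => conj_mem_unitaryGroupOfForm σ T H g'.2))
  have hg' : T⁻¹ * g.1 * T ∈ unitaryGroupOfForm σ (formCongr σ T H) := by
    rw [← conj_mem_unitaryGroupOfForm_iff]
    simpa only [mul_assoc, mul_inv_cancel, mul_one, mul_inv_cancel_left] using g.2
  have hψ : ψ ⟨T⁻¹ * g.1 * T, hg'⟩ = g := by
    apply Subtype.ext
    show T * (T⁻¹ * g.1 * T) * T⁻¹ = g.1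
    group
  have hdet' : (⟨T⁻¹ * g.1 * T, hg'⟩ : ↥(unitaryGroupOfForm σ (formCongr σ T H))).1.1.det = 1 := by
    show ((T⁻¹ * g.1 * T : GL n K) : Matrix n n K).det = 1
    rw [Units.val_mul, Units.val_mul, Matrix.det_mul, Matrix.det_mul, hdet, mul_one, ← Matrix.det_mul,
      ← Units.val_mul, inv_mul_cancel, Units.val_one, Matrix.det_one]
  rw [← hψ]
  exact hH' (χ.comp ψ) _ hdet'

/-- If `SU(H.submatrix e e) ≤ ker χ'` for every `χ'` then `SU(H) ≤ ker χ` for every `χ` (reindexing along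
`e`, determinant preserved). [cite: PlatonovRapinchuk1994, §2.3] -/
theorem apply_eq_one_of_det_eq_one_of_reindex {m n : Type*} [Fintype m] [DecidableEq m] [Fintype n]
    [DecidableEq n] (e : m ≃ n) (H : Matrix n n K)
    (hH' : ∀ (χ' : ↥(unitaryGroupOfForm σ (H.submatrix e e)) →* A) (g' : ↥(unitaryGroupOfForm σ (H.submatrix e e))),
      g'.1.1.det = 1 → χ' g' = 1)
    (χ : ↥(unitaryGroupOfForm σ H) →* A) (g : ↥(unitaryGroupOfForm σ H)) (hdet : g.1.1.det = 1) : χ g = 1 := by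
  let φ : GL m K →* GL n K := (Units.mapEquiv (Matrix.reindexRingEquiv K e).toMulEquiv).toMonoidHom
  let ψ : ↥(unitaryGroupOfForm σ (H.submatrix e e)) →* ↥(unitaryGroupOfForm σ H) :=
    (φ.restrict (unitaryGroupOfForm σ (H.submatrix e e))).codRestrict (unitaryGroupOfForm σ H)
      (fun g' => (reindex_mem_unitaryGroupOfForm_iff σ e H g'.1).1 g'.2)
  -- the preimage of `g`
  let g₀ : GL m K := Units.mapEquiv (Matrix.reindexRingEquiv K e.symm).toMulEquiv g.1
  have hφg₀ : φ g₀ = g.1 := by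
    refine Units.ext ?_
    show Matrix.reindex e e (Matrix.reindex e.symm e.symm (g.1 : Matrix n n K)) = g.1
    rw [Matrix.reindex_apply, Matrix.reindex_apply, Matrix.submatrix_submatrix, Equiv.symm_symm,
      Equiv.self_comp_symm, Matrix.submatrix_id_id]
  have hg₀ : g₀ ∈ unitaryGroupOfForm σ (H.submatrix e e) := by
    rw [reindex_mem_unitaryGroupOfForm_iff]
    show φ g₀ ∈ _
    rw [hφg₀]; exact g.2
  have hψ : ψ ⟨g₀, hg₀⟩ = g := Subtype.ext hφg₀
  have hdet' : (⟨g₀, hg₀⟩ : ↥(unitaryGroupOfForm σ (H.submatrix e e))).1.1.det = 1 := by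
    show (Matrix.reindex e.symm e.symm (g.1 : Matrix n n K)).det = 1
    rw [Matrix.det_reindex_self, hdet]
  rw [← hψ]
  exact hH' (χ.comp ψ) _ hdet'

/-! ## §2 The Witt frame of a diagonal form with a normalised isotropic vector -/

section Frame

variable (hσ : ∀ x, σ (σ x) = x) (hθ : σ θ₀ = -θ₀) (hθ0 : θ₀ ≠ 0) (h2 : (2 : K) ≠ 0)
include hσ hθ hθ0 h2

/-- **The Witt frame**: for `σ dᵢ = dᵢ`, `d₀ ≠ 0` and a normalised isotropic vector `(1, x₁, x₂)`
(`d₀ + σx₁ d₁ x₁ + σx₂ d₂ x₂ = 0`), the basis `e = (1,x₁,x₂)`, `v = (0, d₂ σx₂, −d₁ σx₁)`,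
`f = (θ₀/2d₀)(1, −x₁, −x₂)` has Gram matrix `!![0, 0, θ₀; 0, −d₀d₁d₂, 0; −θ₀, 0, 0]`.
[cite: Dieudonne1971GroupesClassiques, Chap. II §4] -/
theorem formCongr_frame (d : Fin 3 → K) (hd : ∀ i, σ (d i) = d i) (hd0 : d 0 ≠ 0) (x₁ x₂ : K)
    (hx : d 0 + σ x₁ * d 1 * x₁ + σ x₂ * d 2 * x₂ = 0) :
    ((!![(1 : K), 0, θ₀ / (2 * d 0); x₁, d 2 * σ x₂, -(θ₀ * x₁ / (2 * d 0)); x₂, -(d 1 * σ x₁), -(θ₀ * x₂ / (2 * d 0))] :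
        Matrix (Fin 3) (Fin 3) K).map σ)ᵀ * Matrix.diagonal d *
      !![(1 : K), 0, θ₀ / (2 * d 0); x₁, d 2 * σ x₂, -(θ₀ * x₁ / (2 * d 0)); x₂, -(d 1 * σ x₁), -(θ₀ * x₂ / (2 * d 0))] =
      !![(0 : K), 0, θ₀; 0, -(d 0 * d 1 * d 2), 0; -θ₀, 0, 0] := by
  have hσ2 : σ (2 : K) = 2 := map_ofNat σ 2
  ext i j
  fin_cases i <;> fin_cases j <;>
    simp [Matrix.mul_apply, Fin.sum_univ_three, Matrix.diagonal, hd, hσ, hθ, hσ2, map_div₀, map_neg]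
  case «0».«0» => linear_combination hx
  case «0».«1» => ring
  case «0».«2» => field_simp; linear_combination (-1 : K) * hx
  case «1».«0» => ring
  case «1».«1» => linear_combination (d 1 * d 2) * hx
  case «1».«2» => ring
  case «2».«0» => field_simp; linear_combination hx
  case «2».«1» => ring
  case «2».«2» => field_simp; linear_combination (-θ₀ ^ 2) * hx

/-- **Diagonal isotropic forms, normalised isotropic vector `(1, x₁, x₂)`**: every homomorphism
`unitaryGroupOfForm σ (diagonal d) →* A` kills the elements of determinant `1`.
[cite: Dieudonne1971GroupesClassiques, Chap. II §5] -/
theorem apply_eq_one_of_det_eq_one_diagonal_of_head (d : Fin 3 → K) (hd : ∀ i, σ (d i) = d i)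
    (hd0 : ∀ i, d i ≠ 0) (x₁ x₂ : K) (hx : d 0 + σ x₁ * d 1 * x₁ + σ x₂ * d 2 * x₂ = 0)
    (χ : ↥(unitaryGroupOfForm σ (Matrix.diagonal d)) →* A) (g : ↥(unitaryGroupOfForm σ (Matrix.diagonal d)))
    (hdet : g.1.1.det = 1) : χ g = 1 := by
  have hF := formCongr_frame hσ hθ hθ0 h2 d hd (hd0 0) x₁ x₂ hx
  set Tm : Matrix (Fin 3) (Fin 3) K := !![(1 : K), 0, θ₀ / (2 * d 0); x₁, d 2 * σ x₂, -(θ₀ * x₁ / (2 * d 0));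
    x₂, -(d 1 * σ x₁), -(θ₀ * x₂ / (2 * d 0))] with hTm
  have hc : σ (-(d 0 * d 1 * d 2)) = -(d 0 * d 1 * d 2) := by rw [map_neg, map_mul, map_mul, hd, hd, hd]
  have hc0 : -(d 0 * d 1 * d 2) ≠ 0 := neg_ne_zero.2 (mul_ne_zero (mul_ne_zero (hd0 0) (hd0 1)) (hd0 2))
  have hdetJ : (!![(0 : K), 0, θ₀; 0, -(d 0 * d 1 * d 2), 0; -θ₀, 0, 0] : Matrix (Fin 3) (Fin 3) K).det =
      -(d 0 * d 1 * d 2) * θ₀ ^ 2 := by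
    simp [Matrix.det_fin_three]; ring
  have hTdet : Tm.det ≠ 0 := by
    intro h
    have := congrArg Matrix.det hF
    rw [Matrix.det_mul, Matrix.det_mul, h, mul_zero, hdetJ] at this
    exact mul_ne_zero hc0 (pow_ne_zero 2 hθ0) this.symm
  refine apply_eq_one_of_det_eq_one_of_formCongr (Matrix.GeneralLinearGroup.mkOfDetNeZero Tm hTdet)
    (Matrix.diagonal d) _ hF (fun χ' g' h' => ?_) χ g hdet
  exact apply_eq_one_of_det_eq_one hσ hθ hθ0 hc hc0 h2 χ' g' h'

/-- **Diagonal isotropic forms**: for `σ dᵢ = dᵢ ≠ 0` and an isotropic vector `x ≠ 0`, `∑ σ(xᵢ) dᵢ xᵢ = 0`, every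
homomorphism `unitaryGroupOfForm σ (diagonal d) →* A` to a commutative group kills the elements of determinant `1`
(`SU ≤ ker χ`; reduce to a normalised isotropic vector by permuting the coordinates).
[cite: Dieudonne1971GroupesClassiques, Chap. II §5] -/
theorem apply_eq_one_of_det_eq_one_diagonal (d : Fin 3 → K) (hd : ∀ i, σ (d i) = d i) (hd0 : ∀ i, d i ≠ 0)
    (hiso : ∃ x : Fin 3 → K, x ≠ 0 ∧ ∑ i, σ (x i) * d i * x i = 0)
    (χ : ↥(unitaryGroupOfForm σ (Matrix.diagonal d)) →* A) (g : ↥(unitaryGroupOfForm σ (Matrix.diagonal d)))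
    (hdet : g.1.1.det = 1) : χ g = 1 := by
  obtain ⟨x, hx0, hxx⟩ := hiso
  obtain ⟨i, hi⟩ : ∃ i, x i ≠ 0 := Function.ne_iff.mp hx0
  set e : Equiv.Perm (Fin 3) := Equiv.swap 0 i with he
  have hei : e 0 = i := by rw [he, Equiv.swap_apply_left]
  -- the permuted data
  have key : ∀ (χ' : ↥(unitaryGroupOfForm σ ((Matrix.diagonal d).submatrix e e)) →* A)
      (g' : ↥(unitaryGroupOfForm σ ((Matrix.diagonal d).submatrix e e))), g'.1.1.det = 1 → χ' g' = 1 := by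
    rw [Matrix.submatrix_diagonal_equiv]
    intro χ' g' h'
    have hx0' : x (e 0) ≠ 0 := by rw [hei]; exact hi
    have hσx0' : σ (x (e 0)) ≠ 0 := fun h => hx0' (by simpa [hσ] using congrArg σ h)
    refine apply_eq_one_of_det_eq_one_diagonal_of_head hσ hθ hθ0 h2 (d ∘ e) (fun k => hd (e k))
      (fun k => hd0 (e k)) (x (e 1) / x (e 0)) (x (e 2) / x (e 0)) ?_ χ' g' h'
    have hsum : ∑ k, σ (x (e k)) * d (e k) * x (e k) = 0 := by
      rw [Equiv.sum_comp e (fun j => σ (x j) * d j * x j)]; exact hxx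
    rw [Fin.sum_univ_three] at hsum
    simp only [Function.comp_apply, map_div₀]
    field_simp
    linear_combination hsum
  exact apply_eq_one_of_det_eq_one_of_reindex e (Matrix.diagonal d) key χ g hdet

/-- Hypothesis form of `apply_eq_one_of_det_eq_one_diagonal` for a matrix `M` propositionally equal to
`diagonal d` (the shape of the tree's local and archimedean unitary groups, whose forms are `J.map φ`).
[cite: Dieudonne1971GroupesClassiques, Chap. II §5] -/
theorem apply_eq_one_of_det_eq_one_diagonal' (M : Matrix (Fin 3) (Fin 3) K) (d : Fin 3 → K)
    (hM : M = Matrix.diagonal d) (hd : ∀ i, σ (d i) = d i) (hd0 : ∀ i, d i ≠ 0)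
    (hiso : ∃ x : Fin 3 → K, x ≠ 0 ∧ ∑ i, σ (x i) * d i * x i = 0)
    (χ : ↥(unitaryGroupOfForm σ M) →* A) (g : ↥(unitaryGroupOfForm σ M)) (hdet : g.1.1.det = 1) : χ g = 1 := by
  subst hM
  exact apply_eq_one_of_det_eq_one_diagonal hσ hθ hθ0 h2 d hd hd0 hiso χ g hdet

end Frame

end UnitaryRankThree

end Literature.NumberTheory.Automorphic
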